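import Summits.AtomisticToContinuum.Crystallization.Theorems.FrustratedLawDichotomyAperiodicGapFiniteCut
import Summits.AtomisticToContinuum.Crystallization.Theorems.FrustratedLawDichotomyDoublingGap

/-!
# FrustratedLawDichotomy · crux `AperiodicFrustratedLawGap` (stmt-AtomisticToContinuum-27623) — PEELING OFF THE NO-PAIR CLASS `K_w`
# (decomp-a2c, prover hand 2, structural share)

The settled class of `FrustratedLawDichotomyDoublingGap` (`eStar_lt_integral_rootEnergy_of_ae_noPair`: no pair of atoms at offset `-w` within
the 2-shell ⇒ strict gap, modulo the floor of item 9229) is cut off the crux EXACTLY: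

* `isPointStationaryLaw_restrict_of_hc_invariant`, `aperiodicFrustratedLawGap_cut'` — the conditioning lemma and the generic cut with the
  invariance of the event required only ON ROOTED HARD-CORE CONFIGURATIONS (all that the proofs of §1–§3 of
  `FrustratedLawDichotomyAperiodicGapFiniteCut` use), so that events described by countably many ball evaluations qualify;
* the Giry-measurable event `noPair_w = {ν | ∀ n m r, ‖c_n − c_m + w‖ < 2 − 2r → ν B(c_n, r) = 0 ∨ ν B(c_m, r) = 0}` (`c` the dense sequence,
  `r` rational; `measurableSet_noPairEvent`), equal on rooted hard-core configurations to "`2 ≤ ‖s − s' + w‖` for all atoms"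
  (`mem_noPairEvent_iff`), hence invariant there (`noPairEvent_invariant`);
* `aperiodicFrustratedLawGap_iff_offNoPair` — **granted the floor, the crux (by name) is equivalent to its restriction to laws almost surely
  carried by configurations having, for the given `w`, two atoms `s, s'` with `‖s − s' + w‖ < 2`**: counterexamples must have a
  2-relatively-dense difference set (no forbidden offset), which excludes slabs, rods, sparse cluster arrays… in one stroke.  All `[folklore]`.
-/

noncomputable section

namespace Summit.AtomisticToContinuum.Crystallization.Theorems.FrustratedLawDichotomyAperiodicGapFiniteCut

open MeasureTheory Metric Set Filter ProbabilityTheory TopologicalSpace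
open scoped ENNReal Topology BigOperators
open Literature.MathematicalPhysics.StatisticalMechanics Literature.Probability.Process
open Summit.AtomisticToContinuum.Crystallization.Theorems.ChargedEnergyGapNegative (E3 eStar)
open Summit.AtomisticToContinuum.Crystallization.Theorems.FrustratedLawDichotomyFiniteClusterGap
  (ae_mem_of_sep card_mul_eStar_lt_interactionEnergy eStar_lt_integral_rootEnergy_of_ae_noPair)

section NoPairCut

variable {δ : ℝ} {P : Measure (Measure E3)}

/-! ### Conditioning and the generic cut with invariance on hard-core configurations only -/

/-- Conditioning on an event invariant under re-rooting OF ROOTED `δ`-HARD-CORE CONFIGURATIONS keeps a point-stationary law (almost surely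
carried by such configurations) point-stationary. [folklore] -/
theorem isPointStationaryLaw_restrict_of_hc_invariant (hδ : 0 < δ) (hcore : ∀ᵐ μ ∂P, IsRootedHardCore δ μ)
    (hstat : IsPointStationaryLaw P) {H : Set (Measure E3)} (hH : MeasurableSet H)
    (hinv : ∀ μ : Measure E3, IsRootedHardCore δ μ → ∀ p : E3, μ {p} ≠ 0 → (μ ∈ H ↔ Measure.map (fun z : E3 => z - p) μ ∈ H)) :
    IsPointStationaryLaw (P.restrict H) := by
  classical
  intro g hg
  set g' : Measure E3 → E3 → ℝ≥0∞ := fun μ y => H.indicator (fun _ => (1 : ℝ≥0∞)) μ * g μ y with hg'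
  have hg'm : Measurable (Function.uncurry g') :=
    ((measurable_const.indicator hH).comp measurable_fst).mul hg
  have hind : ∀ μ : Measure E3, H.indicator (fun _ => (1 : ℝ≥0∞)) μ ≠ ∞ := fun μ => by
    by_cases h : μ ∈ H <;> simp [h]
  have hfac : ∀ (μ : Measure E3) (F : Measure E3 → ℝ≥0∞),
      H.indicator (fun _ => (1 : ℝ≥0∞)) μ * F μ = H.indicator F μ := fun μ F => by
    by_cases h : μ ∈ H <;> simp [h]
  have key := hstat g' hg'm
  have hL : ∫⁻ μ, ∫⁻ y, g' μ y ∂μ ∂P = ∫⁻ μ in H, ∫⁻ y, g μ y ∂μ ∂P := by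
    rw [← lintegral_indicator hH]
    refine lintegral_congr fun μ => ?_
    simp only [hg']
    rw [lintegral_const_mul' _ _ (hind μ), hfac μ (fun μ => ∫⁻ y, g μ y ∂μ)]
  have hR : ∫⁻ μ, ∫⁻ y, g' (Measure.map (fun z : E3 => z - y) μ) (-y) ∂μ ∂P =
      ∫⁻ μ in H, ∫⁻ y, g (Measure.map (fun z : E3 => z - y) μ) (-y) ∂μ ∂P := by
    rw [← lintegral_indicator hH]
    refine lintegral_congr_ae (hcore.mono fun μ hμ => ?_)
    have hμ' := hμ
    obtain ⟨S, h0, hsep, rfl⟩ := hμ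
    have hae : ∀ᵐ y ∂((Measure.count : Measure E3).restrict S),
        g' (Measure.map (fun z : E3 => z - y) ((Measure.count : Measure E3).restrict S)) (-y) =
          H.indicator (fun _ => (1 : ℝ≥0∞)) ((Measure.count : Measure E3).restrict S) *
            g (Measure.map (fun z : E3 => z - y) ((Measure.count : Measure E3).restrict S)) (-y) := by
      refine (ae_mem_of_sep hδ hsep).mono fun y hy => ?_
      have hy' : (Measure.count : Measure E3).restrict S {y} ≠ 0 := (count_restrict_singleton_ne_zero_iff S y).2 hy
      simp only [hg']
      congr 1
      by_cases hμH : (Measure.count : Measure E3).restrict S ∈ H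
      · rw [Set.indicator_of_mem hμH, Set.indicator_of_mem ((hinv _ hμ' _ hy').1 hμH)]
      · rw [Set.indicator_of_notMem hμH, Set.indicator_of_notMem (fun h => hμH ((hinv _ hμ' _ hy').2 h))]
    beta_reduce
    rw [lintegral_congr_ae hae, lintegral_const_mul' _ _ (hind _),
      hfac _ (fun μ => ∫⁻ y, g (Measure.map (fun z : E3 => z - y) μ) (-y) ∂μ)]
  exact hL.symm.trans (key.trans hR)

/-- `e⋆ < 0`. [folklore] -/
private theorem eStar_neg₅ : eStar < 0 := by
  have h := card_mul_eStar_lt_interactionEnergy (N := 1) one_pos (x := fun _ => (0 : E3)) (fun i j _ => Subsingleton.elim i j)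
  rw [interactionEnergy_of_subsingleton] at h
  simpa using h

/-- **Generic exact cut, invariance on hard-core configurations only.**  As `aperiodicFrustratedLawGap_cut`, but the event `K` need only
be invariant under re-rooting of ROOTED HARD-CORE configurations (for every hard core `δ > 0`). [folklore] -/
theorem aperiodicFrustratedLawGap_cut' (K : Set (MeasureTheory.Measure (EuclideanSpace ℝ (Fin 3)))) (hK : MeasurableSet K)
    (hinvK : ∀ δ : ℝ, 0 < δ → ∀ μ : MeasureTheory.Measure (EuclideanSpace ℝ (Fin 3)), Literature.Probability.Process.IsRootedHardCore δ μ →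
      ∀ p : EuclideanSpace ℝ (Fin 3), μ {p} ≠ 0 → (μ ∈ K ↔ MeasureTheory.Measure.map (fun z : EuclideanSpace ℝ (Fin 3) => z - p) μ ∈ K))
    (hgapK : ∀ δ : ℝ, 0 < δ → ∀ P : MeasureTheory.Measure (MeasureTheory.Measure (EuclideanSpace ℝ (Fin 3))), let Gy : ℝ → (N : ℕ) → (Fin N → EuclideanSpace ℝ (Fin 3)) → Fin N → Prop := fun η N y j => let d : ℝ := sInf ((fun z => dist z (y (j : Fin N))) '' (Set.range (y) \ {(y (j : Fin N))})); let T : Set (EuclideanSpace ℝ (Fin 3)) := {z : EuclideanSpace ℝ (Fin 3) | z ∈ Set.range (y) ∧ z ≠ (y (j : Fin N)) ∧ dist z (y (j : Fin N)) < 13 / 10 * d}; ∃ A : EuclideanSpace ℝ (Fin 3) →ₗᵢ[ℝ] EuclideanSpace ℝ (Fin 3), (∃ e : ↥T ≃ ↥Literature.Geometry.DiscreteGeometry.fccKissingPattern, ∀ t : ↥T, dist (d⁻¹ • ((t : EuclideanSpace ℝ (Fin 3)) - (y (j : Fin N)))) (A ((e t : ↥Literature.Geometry.DiscreteGeometry.fccKissingPattern)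 : EuclideanSpace ℝ (Fin 3))) ≤ η) ∨ (∃ e : ↥T ≃ ↥Literature.Geometry.DiscreteGeometry.hcpKissingPattern, ∀ t : ↥T, dist (d⁻¹ • ((t : EuclideanSpace ℝ (Fin 3)) - (y (j : Fin N)))) (A ((e t : ↥Literature.Geometry.DiscreteGeometry.hcpKissingPattern) : EuclideanSpace ℝ (Fin 3))) ≤ η); let TexBall : (N : ℕ) → (Fin N → EuclideanSpace ℝ (Fin 3)) → Fin N → ℝ → ℝ → ℝ → ℝ → Prop := fun N y i R R₇ R₈ R₉ => (∀ a b : Fin N, a ≠ b → (7 : ℝ) / 10 ≤ dist (y a) (y b)) ∧ (∀ j : Fin N, dist (y j) (y i) ≤ R → ¬ Gy (1 / 20) N (y) j) ∧ (∀ j : Fin N, dist (y j) (y i) ≤ R → ¬ ((∀ j' : Fin N, dist (y j') (y j) ≤ R₇ → ¬ Gy (1 / 20) N (y) j') ∧ (∀ z : EuclideanSpace ℝ (Fin 3), dist z (y j) ≤ R₇ → ∃ k : Fin N, dist z (y k) ≤ 1) ∧ (∀ j' : Fin N, dist (y j') (y j) ≤ R₇ → (let d : ℝ := sInf ((fun z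 => dist z (y j')) '' (Set.range (y) \ {(y j')})); ∀ k : Fin N, y k ≠ y j' → dist (y k) (y j') < 27 / 20 * d → 5 ≤ Nat.card {m : Fin N // y m ≠ y j' ∧ dist (y m) (y j') < 27 / 20 * d ∧ y m ≠ y k ∧ dist (y m) (y k) < 27 / 20 * d})))) ∧ (∀ j : Fin N, dist (y j) (y i) ≤ R → ∃ k : Fin N, dist (y k) (y j) ≤ R₈ ∧ Gy (1 / 8) N (y) k) ∧ (∀ j : Fin N, dist (y j) (y i) ≤ R → ¬ ((∀ j' : Fin N, dist (y j') (y j) ≤ R₉ → ¬ Gy (1 / 20) N (y) j') ∧ (Nat.card {j' : Fin N // dist (y j') (y j) ≤ R₉ ∧ ¬ Gy (1 / 8) N (y) j'} : ℝ) ≤ 1 / 2 * (Nat.card {j' : Fin N // dist (y j') (y j) ≤ R₉} : ℝ) ∧ (∀ j' : Fin N, dist (y j') (y j) ≤ R₉ → ¬ Gy (1 / 8) N (y) j' → ¬ (let d : ℝ := sInf ((fun z => dist z (y j')) '' (Set.range (y) \ {(y j')})); ∀ k : Fin N, y k ≠ y j' → dist (y k) (y j') < 27 / 20 * d → 5 ≤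 Nat.card {m : Fin N // y m ≠ y j' ∧ dist (y m) (y j') < 27 / 20 * d ∧ y m ≠ y k ∧ dist (y m) (y k) < 27 / 20 * d})))); let Appr : MeasureTheory.Measure (EuclideanSpace ℝ (Fin 3)) → ℝ → ℝ → ℝ → Prop := fun μ R₇ R₈ R₉ => ∀ q : EuclideanSpace ℝ (Fin 3), μ {q} ≠ 0 → ∀ R ε : ℝ, 0 < ε → ∃ (N : ℕ) (y : Fin N → EuclideanSpace ℝ (Fin 3)) (i : Fin N), TexBall N y i R R₇ R₈ R₉ ∧ (∀ p : EuclideanSpace ℝ (Fin 3), μ {p} ≠ 0 → dist p q ≤ R → ∃ k : Fin N, dist (y k - y i) (p - q) ≤ ε) ∧ (∀ k : Fin N, dist (y k) (y i) ≤ R → ∃ p : EuclideanSpace ℝ (Fin 3), μ {p} ≠ 0 ∧ dist (y k - y i) (p - q) ≤ ε); MeasureTheory.IsProbabilityMeasure P → (∀ᵐ μ ∂P, Literature.Probability.Process.IsRootedHardCore δ μ) → Literature.Probability.Process.IsPointStationaryLaw P → (∃ R₇ R₈ R₉ : ℝ, ∀ᵐ μ ∂P, Appr μ R₇ R₈ R₉)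 → (∀ᵐ μ ∂P, ∀ p : EuclideanSpace ℝ (Fin 3), μ {p} ≠ 0 → ∀ y : EuclideanSpace ℝ (Fin 3), (∀ q : EuclideanSpace ℝ (Fin 3), μ {q} ≠ 0 → q ≠ p → y ≠ q) → ∑' q : {q : EuclideanSpace ℝ (Fin 3) // μ {q} ≠ 0 ∧ q ≠ p}, Literature.MathematicalPhysics.StatisticalMechanics.lennardJones (dist p (q : EuclideanSpace ℝ (Fin 3))) ≤ ∑' q : {q : EuclideanSpace ℝ (Fin 3) // μ {q} ≠ 0 ∧ q ≠ p}, Literature.MathematicalPhysics.StatisticalMechanics.lennardJones (dist y (q : EuclideanSpace ℝ (Fin 3)))) → P {μ : MeasureTheory.Measure (EuclideanSpace ℝ (Fin 3)) | ∃ Q : Literature.MathematicalPhysics.StatisticalMechanics.PeriodicConfiguration 3, ∃ t : EuclideanSpace ℝ (Fin 3), {p : EuclideanSpace ℝ (Fin 3) | μ {p} ≠ 0} = (fun s => s + t) '' Q.points} = 0 → (∀ᵐ μ ∂P, μ ∈ K) → (⨅ Q : Literature.MathematicalPhysics.StatisticalMechanics.PeriodicConfiguration 3, Q.energyPerParticle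 Literature.MathematicalPhysics.StatisticalMechanics.lennardJones) < (∫ μ, Literature.MathematicalPhysics.StatisticalMechanics.rootEnergy Literature.MathematicalPhysics.StatisticalMechanics.lennardJones μ ∂P)) :
    Summit.AtomisticToContinuum.Crystallization.Theses.FrustratedLawDichotomy.AperiodicFrustratedLawGap ↔
    (∀ δ : ℝ, 0 < δ → ∀ P : MeasureTheory.Measure (MeasureTheory.Measure (EuclideanSpace ℝ (Fin 3))), let Gy : ℝ → (N : ℕ) → (Fin N → EuclideanSpace ℝ (Fin 3)) → Fin N → Prop := fun η N y j => let d : ℝ := sInf ((fun z => dist z (y (j : Fin N))) '' (Set.range (y) \ {(y (j : Fin N))})); let T : Set (EuclideanSpace ℝ (Fin 3)) := {z : EuclideanSpace ℝ (Fin 3) | z ∈ Set.range (y) ∧ z ≠ (y (j : Fin N)) ∧ dist z (y (j : Fin N)) < 13 / 10 * d}; ∃ A : EuclideanSpace ℝ (Fin 3) →ₗᵢ[ℝ] EuclideanSpace ℝ (Fin 3), (∃ e : ↥T ≃ ↥Literature.Geometry.DiscreteGeometry.fccKissingPattern, ∀ t : ↥T, dist (d⁻¹ • ((t : EuclideanSpace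 ℝ (Fin 3)) - (y (j : Fin N)))) (A ((e t : ↥Literature.Geometry.DiscreteGeometry.fccKissingPattern) : EuclideanSpace ℝ (Fin 3))) ≤ η) ∨ (∃ e : ↥T ≃ ↥Literature.Geometry.DiscreteGeometry.hcpKissingPattern, ∀ t : ↥T, dist (d⁻¹ • ((t : EuclideanSpace ℝ (Fin 3)) - (y (j : Fin N)))) (A ((e t : ↥Literature.Geometry.DiscreteGeometry.hcpKissingPattern) : EuclideanSpace ℝ (Fin 3))) ≤ η); let TexBall : (N : ℕ) → (Fin N → EuclideanSpace ℝ (Fin 3)) → Fin N → ℝ → ℝ → ℝ → ℝ → Prop := fun N y i R R₇ R₈ R₉ => (∀ a b : Fin N, a ≠ b → (7 : ℝ) / 10 ≤ dist (y a) (y b)) ∧ (∀ j : Fin N, dist (y j) (y i) ≤ R → ¬ Gy (1 / 20) N (y) j) ∧ (∀ j : Fin N, dist (y j) (y i) ≤ R → ¬ ((∀ j' : Fin N, dist (y j') (y j) ≤ R₇ → ¬ Gy (1 / 20) N (y) j') ∧ (∀ z : EuclideanSpace ℝ (Fin 3), dist z (y j) ≤ R₇ → ∃ k : Fin N, dist z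 (y k) ≤ 1) ∧ (∀ j' : Fin N, dist (y j') (y j) ≤ R₇ → (let d : ℝ := sInf ((fun z => dist z (y j')) '' (Set.range (y) \ {(y j')})); ∀ k : Fin N, y k ≠ y j' → dist (y k) (y j') < 27 / 20 * d → 5 ≤ Nat.card {m : Fin N // y m ≠ y j' ∧ dist (y m) (y j') < 27 / 20 * d ∧ y m ≠ y k ∧ dist (y m) (y k) < 27 / 20 * d})))) ∧ (∀ j : Fin N, dist (y j) (y i) ≤ R → ∃ k : Fin N, dist (y k) (y j) ≤ R₈ ∧ Gy (1 / 8) N (y) k) ∧ (∀ j : Fin N, dist (y j) (y i) ≤ R → ¬ ((∀ j' : Fin N, dist (y j') (y j) ≤ R₉ → ¬ Gy (1 / 20) N (y) j') ∧ (Nat.card {j' : Fin N // dist (y j') (y j) ≤ R₉ ∧ ¬ Gy (1 / 8) N (y) j'} : ℝ) ≤ 1 / 2 * (Nat.card {j' : Fin N // dist (y j') (y j) ≤ R₉} : ℝ) ∧ (∀ j' : Fin N, dist (y j') (y j) ≤ R₉ → ¬ Gy (1 / 8) N (y) j' → ¬ (let d : ℝ := sInf ((fun z => dist z (y j')) ''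 (Set.range (y) \ {(y j')})); ∀ k : Fin N, y k ≠ y j' → dist (y k) (y j') < 27 / 20 * d → 5 ≤ Nat.card {m : Fin N // y m ≠ y j' ∧ dist (y m) (y j') < 27 / 20 * d ∧ y m ≠ y k ∧ dist (y m) (y k) < 27 / 20 * d})))); let Appr : MeasureTheory.Measure (EuclideanSpace ℝ (Fin 3)) → ℝ → ℝ → ℝ → Prop := fun μ R₇ R₈ R₉ => ∀ q : EuclideanSpace ℝ (Fin 3), μ {q} ≠ 0 → ∀ R ε : ℝ, 0 < ε → ∃ (N : ℕ) (y : Fin N → EuclideanSpace ℝ (Fin 3)) (i : Fin N), TexBall N y i R R₇ R₈ R₉ ∧ (∀ p : EuclideanSpace ℝ (Fin 3), μ {p} ≠ 0 → dist p q ≤ R → ∃ k : Fin N, dist (y k - y i) (p - q) ≤ ε) ∧ (∀ k : Fin N, dist (y k) (y i) ≤ R → ∃ p : EuclideanSpace ℝ (Fin 3), μ {p} ≠ 0 ∧ dist (y k - y i) (p - q) ≤ ε); MeasureTheory.IsProbabilityMeasure P → (∀ᵐ μ ∂P, Literature.Probability.Process.IsRootedHardCore δ μ) → Literature.Probability.Process.IsPointStationaryLaw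 P → (∃ R₇ R₈ R₉ : ℝ, ∀ᵐ μ ∂P, Appr μ R₇ R₈ R₉) → (∀ᵐ μ ∂P, ∀ p : EuclideanSpace ℝ (Fin 3), μ {p} ≠ 0 → ∀ y : EuclideanSpace ℝ (Fin 3), (∀ q : EuclideanSpace ℝ (Fin 3), μ {q} ≠ 0 → q ≠ p → y ≠ q) → ∑' q : {q : EuclideanSpace ℝ (Fin 3) // μ {q} ≠ 0 ∧ q ≠ p}, Literature.MathematicalPhysics.StatisticalMechanics.lennardJones (dist p (q : EuclideanSpace ℝ (Fin 3))) ≤ ∑' q : {q : EuclideanSpace ℝ (Fin 3) // μ {q} ≠ 0 ∧ q ≠ p}, Literature.MathematicalPhysics.StatisticalMechanics.lennardJones (dist y (q : EuclideanSpace ℝ (Fin 3)))) → P {μ : MeasureTheory.Measure (EuclideanSpace ℝ (Fin 3)) | ∃ Q : Literature.MathematicalPhysics.StatisticalMechanics.PeriodicConfiguration 3, ∃ t : EuclideanSpace ℝ (Fin 3), {p : EuclideanSpace ℝ (Fin 3) | μ {p} ≠ 0} = (fun s => s + t) '' Q.points} = 0 → (∀ᵐ μ ∂P, μ ∈ Kᶜ)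 → (⨅ Q : Literature.MathematicalPhysics.StatisticalMechanics.PeriodicConfiguration 3, Q.energyPerParticle Literature.MathematicalPhysics.StatisticalMechanics.lennardJones) < (∫ μ, Literature.MathematicalPhysics.StatisticalMechanics.rootEnergy Literature.MathematicalPhysics.StatisticalMechanics.lennardJones μ ∂P)) := by
  constructor
  · intro h δ hδ P
    have h' := h δ hδ P
    dsimp only at h' ⊢
    intro hP ha hb hd he h0 _
    exact h' hP ha hb hd he h0
  · intro h δ hδ P
    have h' := h δ hδ
    have hG := hgapK δ hδ
    dsimp only at h' hG ⊢
    intro hP ha hb hd he h0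
    have hinvKc : ∀ μ : Measure E3, IsRootedHardCore δ μ → ∀ p : E3, μ {p} ≠ 0 →
        (μ ∈ Kᶜ ↔ Measure.map (fun z : E3 => z - p) μ ∈ Kᶜ) :=
      fun μ hμ p hp => by rw [Set.mem_compl_iff, Set.mem_compl_iff, hinvK δ hδ μ hμ p hp]
    by_cases hint : Integrable (fun μ : Measure E3 => rootEnergy lennardJones μ) P
    swap
    · rw [integral_undef hint]; exact eStar_neg₅
    have hframe : ∀ (L : Set (Measure E3)), MeasurableSet L →
        (∀ μ : Measure E3, IsRootedHardCore δ μ → ∀ p : E3, μ {p} ≠ 0 → (μ ∈ L ↔ Measure.map (fun z : E3 => z - p) μ ∈ L)) → P L ≠ 0 →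
        IsProbabilityMeasure ((P L)⁻¹ • P.restrict L) ∧
        (∀ᵐ μ ∂((P L)⁻¹ • P.restrict L), IsRootedHardCore δ μ) ∧
        IsPointStationaryLaw ((P L)⁻¹ • P.restrict L) ∧
        (∀ᵐ μ ∂((P L)⁻¹ • P.restrict L), μ ∈ L) ∧
        ((P L)⁻¹ • P.restrict L) {μ : Measure E3 | ∃ Q : PeriodicConfiguration 3, ∃ t : E3,
            {p : E3 | μ {p} ≠ 0} = (fun s => s + t) '' Q.points} = 0 := by
      intro L hL hinvL hL0
      refine ⟨isProbabilityMeasure_cond' hL0, Measure.ae_smul_measure (ae_restrict_of_ae ha) _,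
        (isPointStationaryLaw_restrict_of_hc_invariant hδ ha hb hL hinvL).smul _, Measure.ae_smul_measure (ae_restrict_mem hL) _, ?_⟩
      rw [Measure.smul_apply, smul_eq_mul]
      refine mul_eq_zero_of_right _ (le_antisymm ?_ bot_le)
      exact (Measure.le_iff'.1 Measure.restrict_le_self _).trans h0.le
    have hpieceK := setIntegral_ge_of_cond (P := P) (K := K) (f := fun μ => rootEnergy lennardJones μ) (c := eStar) (fun hK0 => by
      obtain ⟨hP', ha', hb', hK', h0'⟩ := hframe K hK (hinvK δ hδ) hK0
      refine hG _ hP' ha' hb' ?_ ?_ h0' hK'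
      · obtain ⟨R₇, R₈, R₉, hd'⟩ := hd
        exact ⟨R₇, R₈, R₉, Measure.ae_smul_measure (ae_restrict_of_ae hd') _⟩
      · exact Measure.ae_smul_measure (ae_restrict_of_ae he) _)
    have hpieceKc := setIntegral_ge_of_cond (P := P) (K := Kᶜ) (f := fun μ => rootEnergy lennardJones μ) (c := eStar) (fun hK0 => by
      obtain ⟨hP', ha', hb', hK', h0'⟩ := hframe Kᶜ hK.compl hinvKc hK0
      refine h' _ hP' ha' hb' ?_ ?_ h0' hK'
      · obtain ⟨R₇, R₈, R₉, hd'⟩ := hd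
        exact ⟨R₇, R₈, R₉, Measure.ae_smul_measure (ae_restrict_of_ae hd') _⟩
      · exact Measure.ae_smul_measure (ae_restrict_of_ae he) _)
    have hsum : ∫ μ in K, rootEnergy lennardJones μ ∂P + ∫ μ in Kᶜ, rootEnergy lennardJones μ ∂P =
        ∫ μ, rootEnergy lennardJones μ ∂P := integral_add_compl hK hint
    have hmass : (P K).toReal + (P Kᶜ).toReal = 1 := by
      rw [← ENNReal.toReal_add (measure_ne_top P K) (measure_ne_top P Kᶜ), measure_add_measure_compl hK, measure_univ,
        ENNReal.toReal_one]
    rw [← hsum]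
    change eStar < _
    have hm' : (P K).toReal * eStar + (P Kᶜ).toReal * eStar = eStar := by rw [← add_mul, hmass, one_mul]
    by_cases hK0 : P K = 0
    · have hKc0 : P Kᶜ ≠ 0 := by
        intro h
        rw [hK0, h, ENNReal.toReal_zero, add_zero] at hmass
        exact zero_ne_one hmass
      have h1 := hpieceK.1
      have h2 := hpieceKc.2 hKc0
      linarith
    · have h1 := hpieceK.2 hK0
      have h2 := hpieceKc.1
      linarith

/-! ### The no-pair event in countably many ball evaluations -/

/-- The no-pair event is Giry-measurable (countably many ball evaluations). [folklore] -/
theorem measurableSet_noPairEvent (w : EuclideanSpace ℝ (Fin 3)) :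
    MeasurableSet {ν : Measure E3 | ∀ n m : ℕ, ∀ r : ℚ, (0 : ℝ) < r → ‖denseSeq E3 n - denseSeq E3 m + w‖ < 2 - 2 * (r : ℝ) → ν (ball (denseSeq E3 n) r) = 0 ∨ ν (ball (denseSeq E3 m) r) = 0} := by
  simp only [Set.setOf_forall]
  refine MeasurableSet.iInter fun n => MeasurableSet.iInter fun m => MeasurableSet.iInter fun (r : ℚ) =>
    MeasurableSet.iInter fun _ => MeasurableSet.iInter fun _ => ?_
  have : {ν : Measure E3 | ν (ball (denseSeq E3 n) r) = 0 ∨ ν (ball (denseSeq E3 m) r) = 0} =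
      {ν : Measure E3 | ν (ball (denseSeq E3 n) r) = 0} ∪ {ν : Measure E3 | ν (ball (denseSeq E3 m) r) = 0} := by
    ext ν; simp only [Set.mem_setOf_eq, Set.mem_union]
  rw [this]
  exact ((Measure.measurable_coe measurableSet_ball) (measurableSet_singleton 0)).union
    ((Measure.measurable_coe measurableSet_ball) (measurableSet_singleton 0))

/-- **On rooted hard-core configurations the no-pair event IS the no-pair property**: `count|S` (`S` separated) satisfies the countable
ball conditions iff `2 ≤ ‖s − s' + w‖` for all atoms `s, s'`. [folklore] -/
theorem mem_noPairEvent_iff {μ : Measure E3} (hμ : IsRootedHardCore δ μ) (w : EuclideanSpace ℝ (Fin 3)) :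
    μ ∈ {ν : Measure E3 | ∀ n m : ℕ, ∀ r : ℚ, (0 : ℝ) < r → ‖denseSeq E3 n - denseSeq E3 m + w‖ < 2 - 2 * (r : ℝ) → ν (ball (denseSeq E3 n) r) = 0 ∨ ν (ball (denseSeq E3 m) r) = 0} ↔ ∀ s s' : E3, μ {s} ≠ 0 → μ {s'} ≠ 0 → 2 ≤ ‖s - s' + w‖ := by
  obtain ⟨S, h0, hsep, rfl⟩ := hμ
  have hmem : ∀ s, (Measure.count : Measure E3).restrict S {s} ≠ 0 ↔ s ∈ S := count_restrict_singleton_ne_zero_iff S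
  have hball : ∀ (c : E3) (r : ℝ), (Measure.count : Measure E3).restrict S (ball c r) = 0 ↔ ∀ s ∈ S, r ≤ dist s c := by
    intro c r
    rw [Measure.restrict_apply measurableSet_ball, Measure.count_eq_zero_iff, Set.eq_empty_iff_forall_notMem]
    constructor
    · intro h s hs
      by_contra hlt
      exact h s ⟨mem_ball.2 (lt_of_not_ge hlt), hs⟩
    · rintro h s ⟨hsb, hs⟩
      exact absurd (mem_ball.1 hsb) (not_lt.2 (h s hs))
  have hdense := denseRange_denseSeq E3
  simp only [Set.mem_setOf_eq]
  constructor
  · -- countable conditions ⇒ the property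
    intro h s s' hs hs'
    rw [hmem] at hs hs'
    by_contra hlt
    rw [not_le] at hlt
    -- room `ε`, a rational radius, dense centres
    obtain ⟨q, hq0, hq⟩ := exists_rat_btwn (show (0 : ℝ) < (2 - ‖s - s' + w‖) / 4 by linarith)
    obtain ⟨n, hn⟩ := Metric.denseRange_iff.1 hdense s q hq0
    obtain ⟨m, hm⟩ := Metric.denseRange_iff.1 hdense s' q hq0
    have hcond : ‖denseSeq E3 n - denseSeq E3 m + w‖ < 2 - 2 * (q : ℝ) := by
      have e : denseSeq E3 n - denseSeq E3 m + w = (s - s' + w) + ((denseSeq E3 n - s) - (denseSeq E3 m - s')) := by abel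
      rw [e]
      have h1 : ‖(denseSeq E3 n - s) - (denseSeq E3 m - s')‖ ≤ ‖denseSeq E3 n - s‖ + ‖denseSeq E3 m - s'‖ := norm_sub_le _ _
      have h2 : ‖denseSeq E3 n - s‖ < q := by rw [← dist_eq_norm, dist_comm]; exact hn
      have h3 : ‖denseSeq E3 m - s'‖ < q := by rw [← dist_eq_norm, dist_comm]; exact hm
      linarith [norm_add_le (s - s' + w) ((denseSeq E3 n - s) - (denseSeq E3 m - s'))]
    rcases h n m q (by exact_mod_cast hq0) hcond with hb | hb
    · exact absurd ((hball _ _).1 hb s hs) (not_le.2 hn)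
    · exact absurd ((hball _ _).1 hb s' hs') (not_le.2 hm)
  · -- the property ⇒ countable conditions
    intro h n m r hr hcond
    by_contra hboth
    rw [not_or] at hboth
    obtain ⟨h1, h2⟩ := hboth
    rw [Measure.restrict_apply measurableSet_ball] at h1 h2
    obtain ⟨s, hsb, hs⟩ : (ball (denseSeq E3 n) (r : ℝ) ∩ S).Nonempty :=
      Set.nonempty_iff_ne_empty.2 fun he => h1 (by rw [he, measure_empty])
    obtain ⟨s', hs'b, hs'⟩ : (ball (denseSeq E3 m) (r : ℝ) ∩ S).Nonempty :=
      Set.nonempty_iff_ne_empty.2 fun he => h2 (by rw [he, measure_empty])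
    have hle := h s s' ((hmem s).2 hs) ((hmem s').2 hs')
    have e : s - s' + w = (denseSeq E3 n - denseSeq E3 m + w) + ((s - denseSeq E3 n) - (s' - denseSeq E3 m)) := by abel
    rw [e] at hle
    have h3 : ‖s - denseSeq E3 n‖ < r := by rw [← dist_eq_norm]; exact mem_ball.1 hsb
    have h4 : ‖s' - denseSeq E3 m‖ < r := by rw [← dist_eq_norm]; exact mem_ball.1 hs'b
    linarith [norm_add_le (denseSeq E3 n - denseSeq E3 m + w) ((s - denseSeq E3 n) - (s' - denseSeq E3 m)),
      norm_sub_le (s - denseSeq E3 n) (s' - denseSeq E3 m)]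

/-- The no-pair event is invariant under re-rooting of rooted hard-core configurations. [folklore] -/
theorem noPairEvent_invariant (w : EuclideanSpace ℝ (Fin 3)) :
    ∀ δ : ℝ, 0 < δ → ∀ μ : MeasureTheory.Measure (EuclideanSpace ℝ (Fin 3)), Literature.Probability.Process.IsRootedHardCore δ μ →
      ∀ p : EuclideanSpace ℝ (Fin 3), μ {p} ≠ 0 → (μ ∈ {ν : Measure E3 | ∀ n m : ℕ, ∀ r : ℚ, (0 : ℝ) < r → ‖denseSeq E3 n - denseSeq E3 m + w‖ < 2 - 2 * (r : ℝ) → ν (ball (denseSeq E3 n) r) = 0 ∨ ν (ball (denseSeq E3 m) r) = 0} ↔ MeasureTheory.Measure.map (fun z : EuclideanSpace ℝ (Fin 3) => z - p) μ ∈ {ν : Measure E3 | ∀ n m : ℕ, ∀ r : ℚ, (0 : ℝ) < r → ‖denseSeq E3 n - denseSeq E3 m + w‖ < 2 - 2 * (r : ℝ) → ν (ball (denseSeq E3 n) r) = 0 ∨ ν (ball (denseSeq E3 m) r) = 0}) := by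
  intro δ _ μ hμ p hp
  rw [mem_noPairEvent_iff hμ w, mem_noPairEvent_iff (hμ.map_sub hp) w]
  obtain ⟨S, h0, hsep, rfl⟩ := hμ
  rw [map_sub_count_restrict]
  simp only [count_restrict_singleton_ne_zero_iff]
  constructor
  · rintro h _ _ ⟨s, hs, rfl⟩ ⟨s', hs', rfl⟩
    simpa using h s s' hs hs'
  · intro h s s' hs hs'
    have := h (s - p) (s' - p) ⟨s, hs, rfl⟩ ⟨s', hs', rfl⟩
    simpa using this

/-! ### The cut -/

/-- **The no-pair class peeled off the crux.**  Granted the floor of item 9229 (PROVED in the tree), for every `w` the crux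
`AperiodicFrustratedLawGap` (by name) is EQUIVALENT to its restriction to laws almost surely carried by configurations OUTSIDE the no-pair
event — i.e. having two atoms `s, s'` with `‖s − s' + w‖ < 2`: counterexamples to the crux have a 2-relatively-dense difference set.
[folklore] -/
theorem aperiodicFrustratedLawGap_iff_offNoPair
    (hU : ∀ δ' : ℝ, 0 < δ' → ∀ Q : MeasureTheory.Measure (MeasureTheory.Measure (EuclideanSpace ℝ (Fin 3))), MeasureTheory.IsProbabilityMeasure Q →
      (∀ᵐ μ ∂Q, Literature.Probability.Process.IsRootedHardCore δ' μ) → Literature.Probability.Process.IsPointStationaryLaw Q →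
      (⨅ Q : Literature.MathematicalPhysics.StatisticalMechanics.PeriodicConfiguration 3, Q.energyPerParticle Literature.MathematicalPhysics.StatisticalMechanics.lennardJones) ≤
        ∫ μ, Literature.MathematicalPhysics.StatisticalMechanics.rootEnergy Literature.MathematicalPhysics.StatisticalMechanics.lennardJones μ ∂Q)
    (w : EuclideanSpace ℝ (Fin 3)) :
    Summit.AtomisticToContinuum.Crystallization.Theses.FrustratedLawDichotomy.AperiodicFrustratedLawGap ↔
    (∀ δ : ℝ, 0 < δ → ∀ P : MeasureTheory.Measure (MeasureTheory.Measure (EuclideanSpace ℝ (Fin 3))), let Gy : ℝ → (N : ℕ) → (Fin N → EuclideanSpace ℝ (Fin 3)) → Fin N → Prop := fun η N y j => let d : ℝ := sInf ((fun z => dist z (y (j : Fin N))) '' (Set.range (y) \ {(y (j : Fin N))})); let T : Set (EuclideanSpace ℝ (Fin 3)) := {z : EuclideanSpace ℝ (Fin 3) | z ∈ Set.range (y) ∧ z ≠ (y (j : Fin N)) ∧ dist z (y (j : Fin N)) < 13 / 10 * d}; ∃ A : EuclideanSpace ℝ (Fin 3) →ₗᵢ[ℝ] EuclideanSpace ℝ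 (Fin 3), (∃ e : ↥T ≃ ↥Literature.Geometry.DiscreteGeometry.fccKissingPattern, ∀ t : ↥T, dist (d⁻¹ • ((t : EuclideanSpace ℝ (Fin 3)) - (y (j : Fin N)))) (A ((e t : ↥Literature.Geometry.DiscreteGeometry.fccKissingPattern) : EuclideanSpace ℝ (Fin 3))) ≤ η) ∨ (∃ e : ↥T ≃ ↥Literature.Geometry.DiscreteGeometry.hcpKissingPattern, ∀ t : ↥T, dist (d⁻¹ • ((t : EuclideanSpace ℝ (Fin 3)) - (y (j : Fin N)))) (A ((e t : ↥Literature.Geometry.DiscreteGeometry.hcpKissingPattern) : EuclideanSpace ℝ (Fin 3))) ≤ η); let TexBall : (N : ℕ) → (Fin N → EuclideanSpace ℝ (Fin 3)) → Fin N → ℝ → ℝ → ℝ → ℝ → Prop := fun N y i R R₇ R₈ R₉ => (∀ a b : Fin N, a ≠ b → (7 : ℝ) / 10 ≤ dist (y a) (y b)) ∧ (∀ j : Fin N, dist (y j) (y i) ≤ R → ¬ Gy (1 / 20) N (y) j) ∧ (∀ j : Fin N, dist (y j) (y i) ≤ R → ¬ ((∀ j' : Fin N, dist (y j') (y j) ≤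 R₇ → ¬ Gy (1 / 20) N (y) j') ∧ (∀ z : EuclideanSpace ℝ (Fin 3), dist z (y j) ≤ R₇ → ∃ k : Fin N, dist z (y k) ≤ 1) ∧ (∀ j' : Fin N, dist (y j') (y j) ≤ R₇ → (let d : ℝ := sInf ((fun z => dist z (y j')) '' (Set.range (y) \ {(y j')})); ∀ k : Fin N, y k ≠ y j' → dist (y k) (y j') < 27 / 20 * d → 5 ≤ Nat.card {m : Fin N // y m ≠ y j' ∧ dist (y m) (y j') < 27 / 20 * d ∧ y m ≠ y k ∧ dist (y m) (y k) < 27 / 20 * d})))) ∧ (∀ j : Fin N, dist (y j) (y i) ≤ R → ∃ k : Fin N, dist (y k) (y j) ≤ R₈ ∧ Gy (1 / 8) N (y) k) ∧ (∀ j : Fin N, dist (y j) (y i) ≤ R → ¬ ((∀ j' : Fin N, dist (y j') (y j) ≤ R₉ → ¬ Gy (1 / 20) N (y) j') ∧ (Nat.card {j' : Fin N // dist (y j') (y j) ≤ R₉ ∧ ¬ Gy (1 / 8) N (y) j'} : ℝ) ≤ 1 / 2 * (Nat.card {j' : Fin N // dist (y j') (y j) ≤ R₉} : ℝ) ∧ (∀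 j' : Fin N, dist (y j') (y j) ≤ R₉ → ¬ Gy (1 / 8) N (y) j' → ¬ (let d : ℝ := sInf ((fun z => dist z (y j')) '' (Set.range (y) \ {(y j')})); ∀ k : Fin N, y k ≠ y j' → dist (y k) (y j') < 27 / 20 * d → 5 ≤ Nat.card {m : Fin N // y m ≠ y j' ∧ dist (y m) (y j') < 27 / 20 * d ∧ y m ≠ y k ∧ dist (y m) (y k) < 27 / 20 * d})))); let Appr : MeasureTheory.Measure (EuclideanSpace ℝ (Fin 3)) → ℝ → ℝ → ℝ → Prop := fun μ R₇ R₈ R₉ => ∀ q : EuclideanSpace ℝ (Fin 3), μ {q} ≠ 0 → ∀ R ε : ℝ, 0 < ε → ∃ (N : ℕ) (y : Fin N → EuclideanSpace ℝ (Fin 3)) (i : Fin N), TexBall N y i R R₇ R₈ R₉ ∧ (∀ p : EuclideanSpace ℝ (Fin 3), μ {p} ≠ 0 → dist p q ≤ R → ∃ k : Fin N, dist (y k - y i) (p - q) ≤ ε) ∧ (∀ k : Fin N, dist (y k) (y i) ≤ R → ∃ p : EuclideanSpace ℝ (Fin 3), μ {p} ≠ 0 ∧ dist (y k - y i) (p -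 q) ≤ ε); MeasureTheory.IsProbabilityMeasure P → (∀ᵐ μ ∂P, Literature.Probability.Process.IsRootedHardCore δ μ) → Literature.Probability.Process.IsPointStationaryLaw P → (∃ R₇ R₈ R₉ : ℝ, ∀ᵐ μ ∂P, Appr μ R₇ R₈ R₉) → (∀ᵐ μ ∂P, ∀ p : EuclideanSpace ℝ (Fin 3), μ {p} ≠ 0 → ∀ y : EuclideanSpace ℝ (Fin 3), (∀ q : EuclideanSpace ℝ (Fin 3), μ {q} ≠ 0 → q ≠ p → y ≠ q) → ∑' q : {q : EuclideanSpace ℝ (Fin 3) // μ {q} ≠ 0 ∧ q ≠ p}, Literature.MathematicalPhysics.StatisticalMechanics.lennardJones (dist p (q : EuclideanSpace ℝ (Fin 3))) ≤ ∑' q : {q : EuclideanSpace ℝ (Fin 3) // μ {q} ≠ 0 ∧ q ≠ p}, Literature.MathematicalPhysics.StatisticalMechanics.lennardJones (dist y (q : EuclideanSpace ℝ (Fin 3)))) → P {μ : MeasureTheory.Measure (EuclideanSpace ℝ (Fin 3)) | ∃ Q : Literature.MathematicalPhysics.StatisticalMechanics.PeriodicConfiguration 3, ∃ t : EuclideanSpace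 ℝ (Fin 3), {p : EuclideanSpace ℝ (Fin 3) | μ {p} ≠ 0} = (fun s => s + t) '' Q.points} = 0 → (∀ᵐ μ ∂P, μ ∈ ({ν : MeasureTheory.Measure (EuclideanSpace ℝ (Fin 3)) | ∀ n m : ℕ, ∀ r : ℚ, (0 : ℝ) < r → ‖TopologicalSpace.denseSeq (EuclideanSpace ℝ (Fin 3)) n - TopologicalSpace.denseSeq (EuclideanSpace ℝ (Fin 3)) m + w‖ < 2 - 2 * (r : ℝ) → ν (Metric.ball (TopologicalSpace.denseSeq (EuclideanSpace ℝ (Fin 3)) n) r) = 0 ∨ ν (Metric.ball (TopologicalSpace.denseSeq (EuclideanSpace ℝ (Fin 3)) m) r) = 0})ᶜ) → (⨅ Q : Literature.MathematicalPhysics.StatisticalMechanics.PeriodicConfiguration 3, Q.energyPerParticle Literature.MathematicalPhysics.StatisticalMechanics.lennardJones) < (∫ μ, Literature.MathematicalPhysics.StatisticalMechanics.rootEnergy Literature.MathematicalPhysics.StatisticalMechanics.lennardJones μ ∂P)) := by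
  refine aperiodicFrustratedLawGap_cut' _ (measurableSet_noPairEvent w) (noPairEvent_invariant w) ?_
  intro δ hδ P
  dsimp only
  intro _hP ha hb _ _ _ hK
  refine eStar_lt_integral_rootEnergy_of_ae_noPair hU hδ ha hb w ?_
  filter_upwards [ha, hK] with μ hμ hμK
  exact (mem_noPairEvent_iff hμ w).1 hμK

end NoPairCut

end Summit.AtomisticToContinuum.Crystallization.Theorems.FrustratedLawDichotomyAperiodicGapFiniteCut

end
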